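import Literature.MathematicalPhysics.QuantumFieldTheory.Balaban1983to89.B9Eq326LocalPartDivergenceBlockLetterClosed
import Literature.MathematicalPhysics.QuantumFieldTheory.Balaban1983to89.B9Eq342GradientRowComparisonMassUniform
import Literature.MathematicalPhysics.QuantumFieldTheory.Balaban1983to89.B9Eq342GradientRowPureGauge

/-!
# `Balaban1983to89.B9Eq326LocalPartGradientRowsWindows` — T. Bałaban, *Propagators for lattice gauge theories in a background field*, Commun. Math. Phys.
# **99** (1985) 389–434 [Balaban1985BackgroundPropagators] Thm 3.1 (3.42) p. 397 (*«B₀, δ₀ depend on d and L only»* — constants uniform in the lattice spacing),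
# (3.26) p. 395, with [Balaban1984PropagatorsI] (1.29) p. 23, p. 36: **STOREY J's WINDOW ARITHMETIC FOR THE GRADIENT ROWS OF `A₀` — the `cosh`-currency windows
# of this lineage's (K57) `B9Eq326LocalPartDivergenceBlockLetterClosed` (`0 ≤ θ`, `r ≤ θL`, `0 < m`, `2dη⁻²(cosh θ − 1) < m`, `0 < β′ ≤ B_ν`, `θ ≤ κ′`, `η⁻¹B_ν ≤ C ≤
# K∕√m`, `2η⁻¹b(e^{κ′}+1)dK ≤ √m`) are DISCHARGED by ONE choice, uniform in `η = 1∕L`: `θ := rη` (so `θL = r`), `β′ := β₀(η⁻¹, m, rη)` ((K34) §5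
# `B9Eq342GradientRowPureGauge.direction_constant_lower_bound`), `κ′ := 1`, `C := C_W(m, r, 1)`, `K := C√m` ((K37) `B9Eq342GradientRowComparisonMassUniform`:
# `η⁻¹B_ν ≤ C_W` under the t-free window `4d(cosh r − 1) ≤ m`, `C_W ≤ (3√2 + 4 sinh r)∕√m` for `m ≥ 2`), leaving THREE t-free conditions on the comparison
# mass `m`: `2 ≤ m`, `4d(cosh r − 1) ≤ m`, `2·(η⁻¹·2M_φM_φ′ε_U)·(e+1)·d·(3√2 + 4 sinh r) ≤ √m`** (the last is t-free exactly when `Lε_U` is bounded — the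
# model's (3.35)-type content; successor memo `t4/b2b-balaban-t4-ne9-formalise-leaf-05/g85/STOREY-J-A0-MAP-g85.md` §3 (e))

statement-level skeleton of published theorems with citation tags; proofs where landed; nothing here is a claim about the Yang–Mills mass gap

CITATION HEADER (lean-in-tree rule).  Audit cell `pub-balaban`, sub-cell `t4`, BINDER row NE9; filed by NE9 crux-team LEAF PROVER 05
(`b2b-balaban-t4-ne9-formalise-leaf-05`, gen 86).  Imports this lineage's (K57) `B9Eq326LocalPartDivergenceBlockLetterClosed`, (K37)
`B9Eq342GradientRowComparisonMassUniform` (t4-ne9-idea-1 g144 kernel F, ported by g83) and (K34) `B9Eq342GradientRowPureGauge` §5.  SOURCE READ first-hand in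
the held text layer [Balaban1985BackgroundPropagators] (`paper:balaban1985-cmp99-background-propagators`): p. 397 Thm 3.1 (3.42) and p. 398 (the sentence on
`B₀`); p. 395 (3.26); [Balaban1984PropagatorsI] p. 23 (1.29), p. 36.  [folklore] arithmetic BY NAME; nothing printed is a hypothesis; the `[cite: …]` tags are
TEXT LOCATIONS.

WHAT IS PROVED (sorry-free; 0 `def`; [folklore]).  §1 **`norm_covDivL2K_localInv_le_blockLetter_of_mass`** — (K57) §1 with the eleven window binders replaced by
`2 ≤ m`, `4d(cosh r − 1) ≤ m`, `2·(η⁻¹·2M_φM_φ′ε_U)·(e+1)·d·((1 + 2)√2 + 4 sinh r) ≤ √m`; the (L) letter of `D*_U(A₀⁻¹f)` is the constant of (K57) §1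
EVALUATED at `θ = rη`, `β′ = β₀`.  §2 **`norm_localInv_covDerivL2K_le_blockLetter_of_mass`** — (K57) §2 (the transposed row `A₀⁻¹D_U`, price `L^d`) under the same choice.
READING (t4-ne9-idea-1 g152 L-g152-10, adopted).  The three conditions ORDER the choices: `m` first (`m ≥ max(2, 4d(cosh r − 1))`, background-free), then the
background: with `η⁻¹ = L` the third reads `ε_U ≤ √m·(4·L·M_φM_φ′·(e+1)·d·((1+2)√2 + 4 sinh r))⁻¹` — a CLOSED-FORM smallness window on the (3.35)-type letter `ε_U`
given `m` (the queue item (F24) «(3.35) AS HYPOTHESIS per cube» displayed in closed form; it stays a hypothesis on the background).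
HEARTBEATS.  Both theorems carry `set_option maxHeartbeats 400000 in` (the directory's idiom): at the default 200 000 they pass with < 15 % margin
(a 170 000 probe times out in the final `exact`'s unification of the written-out constant), so the hub build's extra cost would risk «accepted, never built».
HONEST SCOPE.  Arithmetic only; the three mass conditions are the consumer's (any `m ≥ max` of the three bounds); the constant is written out, not simplified
(it is `O(√m·(1 + c_P + m))`-shaped with `c_P` the order-zero constant); `ε_U`, `a_U`, `δ`, `γ` remain the model's letters; §2 is §1's twin for the transposed row; nothing of [B9] Thm 3.1∕3.3∕3.11 is asserted, valued or discharged.  NOT NE9 (cell pub-balaban: NE9 NOT PRINTED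
∕ NOT PROVED; «NE9 ⇐ the named binders»; row WALLED ON A MODEL (O-NE9-1; #5 UNRULED); spine PROVED 0∕9; rung (B)+1 on a finite T⁴ — NOT infinite volume,
NOT mass gap, NOT Clay; HONEST DEPENDENCY: continuum YM on T⁴ ⇐ BetaPertH ∧ nine spine estimates (0/9 proved); BetaPertH ⇐ (D1) ∧ (D4) ∧ CAP+tail; G-an2-4
gates asym, D1 and NE2/3/4).  NEW file; nothing modified.  Net new unproved facts: 0.
-/

noncomputable section

set_option autoImplicit false

open scoped InnerProductSpace ComplexConjugate BigOperators
open NormedSpace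

namespace Literature.MathematicalPhysics.QuantumFieldTheory.Balaban1983to89.B9Eq326LocalPartGradientRowsWindows

open B4Sect5Torus (TSite tdist)
open B4TorusKernel.MultiPeriod (circAbs)
open B9SectCLatticeCarrier (Bond DirPair bpos btgt shift unshift)
open B9Eq311L2Pairing (WL2)
open B9Eq319QprimeTorus (fineP blockCoord)
open B7Prop1Explicit (U1 Wcx boxVec)
open B11Eq103H1Complex (SiteL2K BondL2K greenK covDerivL2K covDivL2K)
open B9Eq310DeltaPrime (reHol imHol)
open B9Eq310HessianOperator (adTransportW PlaqL2K curvOp hessOp)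
open B9Eq315QTorus (perCfg cornerSite QtorusW)
open B9Eq326LocalPartDivergenceBlockLetterClosed (norm_covDivL2K_localInv_le_blockLetter)
open B9Eq342GradientRowComparisonMassUniform (window_of_tfree_window mul_weighted_row_le_uniform uniform_const_le_of_two_le)
open B9Eq342GradientRowPureGauge (direction_constant_lower_bound)

variable {d : ℕ} (L : ℕ) [NeZero L] (m : Fin d → ℕ) [∀ i, NeZero (m i)] [∀ i, NeZero (fineP L m i)]
  {𝔸 : Type*} [NormedRing 𝔸] [StarRing 𝔸] [NormedAlgebra ℂ 𝔸] [StarModule ℂ 𝔸] [NormOneClass 𝔸] [CompleteSpace 𝔸] (hL : 1 ≤ L)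
  {W : Type*} [NormedAddCommGroup W] [InnerProductSpace ℂ W] [FiniteDimensional ℂ W] (φ : W ≃ₗ[ℂ] 𝔸) {Mφ Mφ' : ℝ}
  (hφ : ∀ w, ‖φ w‖ ≤ Mφ * ‖w‖) (hφ' : ∀ X, ‖φ.symm X‖ ≤ Mφ' * ‖X‖) (hMφ : 0 ≤ Mφ) (hMφ' : 0 ≤ Mφ') (hstar : ∀ X : 𝔸, ‖star X‖ ≤ ‖X‖)
  {c₀ c₁ : ℝ} [Fact (0 < c₀)] [Fact (0 < c₁)] {η : ℝ} (hη : 0 < η) (hηL : η * L = 1)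
  (U : Bond d (fineP L m) → 𝔸ˣ) (hU : ∀ b, U b ∈ U1 𝔸)
  (hRS : ∀ (b : Bond d (fineP L m)) (v u : W), ⟪adTransportW φ U b v, u⟫_ℂ = ⟪v, adTransportW φ (fun b => (U b)⁻¹) b u⟫_ℂ)
  {α : ℝ} (hα1 : α ≤ 1 / 64)
  (hU1 : ∀ (x : B7Prop1Explicit.Site d) (k : Fin d), perCfg (fineP L m) U x k ∈ U1 𝔸)
  (hreg : ∀ (y : TSite d m) (k : Fin d) (ρ : Fin d → Fin L),
    ‖((Wcx L (perCfg (fineP L m) U) (cornerSite L y) k (boxVec L ρ) : 𝔸ˣ) : 𝔸) - 1‖ ≤ α)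
  {α' : ℝ} (hα1' : α' ≤ 1 / 64)
  (hU1' : ∀ (x : B7Prop1Explicit.Site d) (k : Fin d), perCfg (fineP L m) (fun _ : Bond d (fineP L m) => (1 : 𝔸ˣ)) x k ∈ U1 𝔸)
  (hreg' : ∀ (y : TSite d m) (k : Fin d) (ρ : Fin d → Fin L),
    ‖((Wcx L (perCfg (fineP L m) (fun _ : Bond d (fineP L m) => (1 : 𝔸ˣ))) (cornerSite L y) k (boxVec L ρ) : 𝔸ˣ) : 𝔸) - 1‖ ≤ α')
  {εU : ℝ} (hεU : 0 ≤ εU) (hUε : ∀ b : Bond d (fineP L m), ‖(U b : 𝔸) - 1‖ ≤ εU)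
  (τ : 𝔸 →ₗ[ℂ] ℂ) {Mτ : ℝ} (hτ : ∀ X Y : 𝔸, ‖τ (X * Y)‖ ≤ Mτ * ‖X‖ * ‖Y‖) (hMτ : 0 ≤ Mτ)
  {δ : ℝ} (hδ : 0 ≤ δ)
  (hRe : ∀ p : B9SectCLatticeCarrier.Plaq d (fineP L m), ‖reHol U p - 1‖ ≤ δ)
  (hIm : ∀ p : B9SectCLatticeCarrier.Plaq d (fineP L m), ‖imHol U p‖ ≤ δ)
  (a : ℝ) (ha : 0 ≤ a) (hm : ∀ i, 1 ≤ m i)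
  (A₀ : BondL2K ℂ d (fineP L m) c₀ W →ₗ[ℂ] BondL2K ℂ d (fineP L m) c₀ W)
  (hA₀ : A₀ = hessOp φ η U τ + covDerivL2K ℂ c₀ ((η : ℂ))⁻¹ (adTransportW φ U) ∘ₗ covDivL2K ℂ c₀ ((η : ℂ))⁻¹ (adTransportW φ fun b => (U b)⁻¹) +
    LinearMap.adjoint (QtorusW L m hL φ U hα1 hU1 hreg (c₀ := c₀) (c₁ := c₁)) ∘ₗ
      ((a : ℂ) • QtorusW L m hL φ U hα1 hU1 hreg (c₀ := c₀) (c₁ := c₁)))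
  (hpos₀ : ∀ x : BondL2K ℂ d (fineP L m) c₀ W, x ≠ 0 → 0 < RCLike.re ⟪x, A₀ x⟫_ℂ)
  {γ β r : ℝ} (hγ : 0 < γ) (hβ : 0 ≤ β) (hr : 0 ≤ r)
  (hcoer : ∀ f : BondL2K ℂ d (fineP L m) c₀ W, γ * ‖f‖ ^ 2 ≤ RCLike.re ⟪f, A₀ f⟫_ℂ)
  (hwin : r * η ≤ 1) (hr4 : 4 * r ≤ 1)
  (hβCC : 4 * r * (Mφ * Mφ') * (d * Real.sqrt d) ≤ β) (hβC : 4 * r * (Mφ * Mφ') * d ≤ β) (hβD : 2 * r * (Mφ * Mφ') * Real.sqrt d ≤ β)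
  (hβQ : 8 * r * (Mφ' * Mφ * Real.sqrt (2 * (c₁ / c₀) * (2 * d * (102 * (d + 1) ^ 2 * L * εU) ^ 2 + ((L : ℝ) ^ d)⁻¹))) ≤ β)
  (small : (768 * Fintype.card (DirPair d) * Mτ * Mφ ^ 2 * (‖((η : ℂ)) ^ d‖ / c₀) * ‖((η : ℂ))⁻¹‖ ^ 2 * δ) / 2 + 3 * (2 + a) * β ^ 2 +
    8 * (r * η) * (768 * Fintype.card (DirPair d) * Mτ * Mφ ^ 2 * (‖((η : ℂ)) ^ d‖ / c₀) * ‖((η : ℂ))⁻¹‖ ^ 2 * δ) ≤ γ / 4)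
  (PB : TSite d m → BondL2K ℂ d (fineP L m) c₀ W →L[ℂ] BondL2K ℂ d (fineP L m) c₀ W)
  (hPB : ∀ (y : TSite d m) (f : BondL2K ℂ d (fineP L m) c₀ W) (b : Bond d (fineP L m)),
    WL2.equiv ℂ (fun _ : Bond d (fineP L m) => c₀) W (PB y f) b =
      if blockCoord L m (bpos b) = y then WL2.equiv ℂ (fun _ : Bond d (fineP L m) => c₀) W f b else 0)
  (v : TSite d m) (f : BondL2K ℂ d (fineP L m) c₀ W) {F : ℝ} (hF : 0 ≤ F)
  (hfv : ∀ b, blockCoord L m (bpos b) ≠ v → WL2.equiv ℂ (fun _ : Bond d (fineP L m) => c₀) W f b = 0)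
  (hfF : ∀ b, ‖WL2.equiv ℂ (fun _ : Bond d (fineP L m) => c₀) W f b‖ ≤ F)

set_option maxHeartbeats 400000 in
include hφ hφ' hMφ hMφ' hstar hη hηL hU hRS hα1' hU1' hreg' hεU hUε hτ hMτ hδ hRe hIm ha hm hA₀ hγ hβ hr hcoer hwin hr4 hβCC hβC hβD hβQ small hPB hfv
  hfF hF hL in
/-- **(K57) §1 UNDER ONE UNIFORM MASS CHOICE** — see the module header: `θ := rη`, `β′ := β₀(η⁻¹, m, rη)`, `κ′ := 1`, `C := C_W(m, r, 1)`, `K := C√m`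
discharge every window of `B9Eq326LocalPartDivergenceBlockLetterClosed.norm_covDivL2K_localInv_le_blockLetter`, given `2 ≤ m`, `4d(cosh r − 1) ≤ m` and
`2·(η⁻¹·2M_φM_φ′ε_U)·(e+1)·d·((1+2)√2 + 4 sinh r) ≤ √m`; the conclusion is that theorem's letter evaluated at the choice. [folklore]
[cite: Balaban1985BackgroundPropagators, Thm 3.1 (3.42) p.397, p.398, (3.26) p.395; Balaban1984PropagatorsI, (1.29) p.23, p.36] -/
theorem norm_covDivL2K_localInv_le_blockLetter_of_mass (hd : 1 ≤ d) (hn : ∀ ν, 2 ≤ fineP L m ν)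
    {aU : ℝ} (haU : 0 ≤ aU) (hUa : ∀ (x : TSite d (fineP L m)) (μ : Fin d), ‖(U (x, μ) : 𝔸) - (U (unshift μ x, μ) : 𝔸)‖ ≤ aU)
    {mm : ℝ} (hmm2 : 2 ≤ mm) (hwin4 : 4 * (d : ℝ) * (Real.cosh r - 1) ≤ mm)
    (hmε : 2 * ((η⁻¹ * (2 * Mφ * Mφ' * εU)) * (Real.exp 1 + 1) * (d : ℝ) * ((1 + 2 / 1) * Real.sqrt 2 + 4 * Real.sinh r)) ≤ Real.sqrt mm)
    (y : TSite d (fineP L m)) :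
    ‖WL2.equiv ℂ (fun _ : TSite d (fineP L m) => c₀) W
        (covDivL2K ℂ c₀ ((η : ℂ))⁻¹ (adTransportW φ fun b => (U b)⁻¹) (greenK A₀ hpos₀ f)) y‖ ≤
      (2 * Real.exp ((r * η) * ((L : ℝ) - 1)) *
        ((2 * ‖((η⁻¹ : ℝ) : ℂ)‖ * ∑ ν, (fun ν : Fin d => (1 + Real.exp (-(r * η))) *
        ((1 + 2 * η⁻¹ / (fineP L m ν * Real.sqrt (mm - 2 * ((d : ℝ) - 1) * η⁻¹ ^ 2 * (Real.cosh (r * η) - 1)))) /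
          Real.sqrt ((mm - 2 * ((d : ℝ) - 1) * η⁻¹ ^ 2 * (Real.cosh (r * η) - 1)) ^ 2 + 4 * (mm - 2 * ((d : ℝ) - 1) * η⁻¹ ^ 2 * (Real.cosh (r * η) - 1)) * η⁻¹ ^ 2)) +
        2 * Real.sinh (r * η) / (mm - 2 * (d : ℝ) * η⁻¹ ^ 2 * (Real.cosh (r * η) - 1))) ν) +
          (2 * (‖((η⁻¹ : ℝ) : ℂ)‖ * (((768 * Fintype.card (DirPair d) * Mτ * Mφ ^ 2 * (‖((η : ℂ)) ^ d‖ / c₀) * ‖((η : ℂ))⁻¹‖ ^ 2 * δ * Real.exp (r * η) ^ 2 +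
          |a| * (c₁ / c₀ * (Mφ' * (1 + 50 * (d + 1) * α) * Mφ) * ((2 * d : ℕ) : ℝ) * (Mφ' * (1 + 50 * (d + 1) * α) * Mφ)) *
            Real.exp ((r * η) * (d : ℝ) * ((L : ℝ) * 2 + ((L : ℝ) - 1))) +
          ‖((η : ℂ))⁻¹ * ((η : ℂ))⁻¹‖ * ((d - 1 : ℝ) * (2 * Mφ * Mφ' * (2 * δ)) * Real.exp (r * η) ^ 2)) + ‖((mm : ℝ) : ℂ)‖) +
              (d : ℝ) * (η⁻¹ ^ 2 * (2 * Mφ * Mφ' * aU + (2 * Mφ * Mφ' * εU) * (2 * Mφ * Mφ' * εU)))) + |η⁻¹| * (2 * Mφ * Mφ' * εU) / ((1 + Real.exp (-(r * η))) / Real.sqrt ((mm - 2 * ((d : ℝ) - 1) * η⁻¹ ^ 2 * (Real.cosh (r * η) - 1)) ^ 2 +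
              4 * (mm - 2 * ((d : ℝ) - 1) * η⁻¹ ^ 2 * (Real.cosh (r * η) - 1)) * η⁻¹ ^ 2))) *
            (∑ ν, (fun ν : Fin d => (1 + Real.exp (-(r * η))) *
        ((1 + 2 * η⁻¹ / (fineP L m ν * Real.sqrt (mm - 2 * ((d : ℝ) - 1) * η⁻¹ ^ 2 * (Real.cosh (r * η) - 1)))) /
          Real.sqrt ((mm - 2 * ((d : ℝ) - 1) * η⁻¹ ^ 2 * (Real.cosh (r * η) - 1)) ^ 2 + 4 * (mm - 2 * ((d : ℝ) - 1) * η⁻¹ ^ 2 * (Real.cosh (r * η) - 1)) * η⁻¹ ^ 2)) +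
        2 * Real.sinh (r * η) / (mm - 2 * (d : ℝ) * η⁻¹ ^ 2 * (Real.cosh (r * η) - 1))) ν)) * (4 / γ * Real.exp r * Real.sqrt (d * (L : ℝ) ^ d)))) * F * Real.exp (-(r * tdist m (blockCoord L m y) v)) := by
  -- the units: `η⁻¹ = L ≥ 1`, `η ≤ 1`
  have hinvL : η⁻¹ = (L : ℝ) := inv_eq_of_mul_eq_one_right hηL
  have hL1 : (1 : ℝ) ≤ (L : ℝ) := by exact_mod_cast hL
  have ht : (1 : ℝ) ≤ η⁻¹ := by rw [hinvL]; exact hL1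
  have ht0 : (0 : ℝ) < η⁻¹ := by linarith
  have hη1 : η ≤ 1 := by
    have h := mul_le_mul_of_nonneg_left hL1 hη.le
    rw [mul_one, hηL] at h
    exact h
  have hmm : 0 < mm := by linarith
  have hsm : 0 < Real.sqrt mm := Real.sqrt_pos.2 hmm
  -- the rate `θ := rη`
  have hθ : 0 ≤ r * η := mul_nonneg hr hη.le
  have hrθ : r ≤ r * η * (L : ℝ) := by rw [mul_assoc, hηL, mul_one]
  have hθκ : r * η ≤ 1 := by
    have h1 : r * η ≤ r * 1 := mul_le_mul_of_nonneg_left hη1 hr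
    linarith
  have hrdiv : r / η⁻¹ = r * η := div_inv_eq_mul r η
  -- the `cosh` window from the t-free window
  have hlam4 := window_of_tfree_window ht hr d hwin4
  rw [hrdiv] at hlam4
  have hlam : 2 * (d : ℝ) * η⁻¹ ^ 2 * (Real.cosh (r * η) - 1) < mm := by
    have hc : 0 ≤ Real.cosh (r * η) - 1 := by linarith [Real.one_le_cosh (r * η)]
    have h0 : 0 ≤ (d : ℝ) * (η⁻¹ ^ 2 * (Real.cosh (r * η) - 1)) := by positivity
    have e : 2 * (d : ℝ) * η⁻¹ ^ 2 * (Real.cosh (r * η) - 1) = 2 * ((d : ℝ) * (η⁻¹ ^ 2 * (Real.cosh (r * η) - 1))) := by ring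
    rw [e]
    linarith
  -- the direction-free lower bound `β₀`
  have hβ0 := fun ν => direction_constant_lower_bound (N := fineP L m) η⁻¹ mm (r * η) ht0 hθ hlam ν
  have hd0 : 0 < d := hd
  -- the η-uniform row gain `C_W`
  have hCW : 0 ≤ ((1 + 2 / (1 * Real.sqrt (mm / 2))) / Real.sqrt (mm / 2) + 4 * Real.sinh r / mm) := by
    have hs : 0 ≤ Real.sinh r := Real.sinh_nonneg_iff.2 hr
    positivity
  have hLn : ∀ ν : Fin d, (1 : ℝ) * η⁻¹ ≤ (fineP L m ν : ℝ) := fun ν => by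
    rw [one_mul, hinvL]
    have h1 : L * 1 ≤ fineP L m ν := Nat.mul_le_mul_left L (hm ν)
    rw [mul_one] at h1
    exact_mod_cast h1
  have hnorm : ‖((η⁻¹ : ℝ) : ℂ)‖ = η⁻¹ := by rw [Complex.norm_real, Real.norm_eq_abs, abs_of_pos ht0]
  have habs : |η⁻¹| = η⁻¹ := abs_of_pos ht0
  have htB : ∀ ν, ‖((η⁻¹ : ℝ) : ℂ)‖ * (fun ν : Fin d => (1 + Real.exp (-(r * η))) *
        ((1 + 2 * η⁻¹ / (fineP L m ν * Real.sqrt (mm - 2 * ((d : ℝ) - 1) * η⁻¹ ^ 2 * (Real.cosh (r * η) - 1)))) /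
          Real.sqrt ((mm - 2 * ((d : ℝ) - 1) * η⁻¹ ^ 2 * (Real.cosh (r * η) - 1)) ^ 2 + 4 * (mm - 2 * ((d : ℝ) - 1) * η⁻¹ ^ 2 * (Real.cosh (r * η) - 1)) * η⁻¹ ^ 2)) +
        2 * Real.sinh (r * η) / (mm - 2 * (d : ℝ) * η⁻¹ ^ 2 * (Real.cosh (r * η) - 1))) ν ≤ ((1 + 2 / (1 * Real.sqrt (mm / 2))) / Real.sqrt (mm / 2) + 4 * Real.sinh r / mm) := fun ν => by
    have h := mul_weighted_row_le_uniform η⁻¹ ht (m := mm) (κ := r) (n := (fineP L m ν : ℝ)) (L := 1) hmm hr one_pos (hLn ν) d hwin4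
    rw [hrdiv] at h
    rw [hnorm]
    exact h
  have hCK : ((1 + 2 / (1 * Real.sqrt (mm / 2))) / Real.sqrt (mm / 2) + 4 * Real.sinh r / mm) ≤ ((1 + 2 / (1 * Real.sqrt (mm / 2))) / Real.sqrt (mm / 2) + 4 * Real.sinh r / mm) * Real.sqrt mm / Real.sqrt mm :=
    (mul_div_cancel_right₀ _ hsm.ne').symm.le
  have hmK : 2 * ((|η⁻¹| * (2 * Mφ * Mφ' * εU)) * (Real.exp 1 + 1) * (d : ℝ) * (((1 + 2 / (1 * Real.sqrt (mm / 2))) / Real.sqrt (mm / 2) + 4 * Real.sinh r / mm) * Real.sqrt mm)) ≤ Real.sqrt mm := by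
    have hCle := uniform_const_le_of_two_le (κ := r) (L := (1 : ℝ)) hmm2 hr one_pos
    have hb0 : 0 ≤ (|η⁻¹| * (2 * Mφ * Mφ' * εU)) * (Real.exp 1 + 1) * (d : ℝ) := by positivity
    rw [habs] at hb0 ⊢
    calc 2 * ((η⁻¹ * (2 * Mφ * Mφ' * εU)) * (Real.exp 1 + 1) * (d : ℝ) * (((1 + 2 / (1 * Real.sqrt (mm / 2))) / Real.sqrt (mm / 2) + 4 * Real.sinh r / mm) * Real.sqrt mm))
        = 2 * ((η⁻¹ * (2 * Mφ * Mφ' * εU)) * (Real.exp 1 + 1) * (d : ℝ)) * (((1 + 2 / (1 * Real.sqrt (mm / 2))) / Real.sqrt (mm / 2) + 4 * Real.sinh r / mm) * Real.sqrt mm) := by ring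
      _ ≤ 2 * ((η⁻¹ * (2 * Mφ * Mφ' * εU)) * (Real.exp 1 + 1) * (d : ℝ)) *
            (((1 + 2 / 1) * Real.sqrt 2 + 4 * Real.sinh r) / Real.sqrt mm * Real.sqrt mm) :=
          mul_le_mul_of_nonneg_left (mul_le_mul_of_nonneg_right hCle hsm.le) (by positivity)
      _ = 2 * ((η⁻¹ * (2 * Mφ * Mφ' * εU)) * (Real.exp 1 + 1) * (d : ℝ) * ((1 + 2 / 1) * Real.sqrt 2 + 4 * Real.sinh r)) := by
          rw [div_mul_cancel₀ _ hsm.ne']; ring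
      _ ≤ Real.sqrt mm := hmε
  exact norm_covDivL2K_localInv_le_blockLetter L m hL φ hφ hφ' hMφ hMφ' hstar hη hηL U hU hRS hα1 hU1 hreg hα1' hU1' hreg' hεU hUε τ hτ hMτ hδ hRe hIm
    a ha hm A₀ hA₀ hpos₀ hγ hβ hr hcoer hwin hr4 hβCC hβC hβD hβQ small PB hPB v f hF hfv hfF hd hn haU hUa hθ hrθ hmm hlam (hβ0 ⟨0, hd0⟩).1
    (fun ν => (hβ0 ν).2) hθκ hCW htB hCK hmK y

set_option maxHeartbeats 400000 in
include hφ hφ' hMφ hMφ' hstar hη hηL hU hRS hα1' hU1' hreg' hεU hUε hτ hMτ hδ hRe hIm ha hm hA₀ hγ hβ hr hcoer hwin hr4 hβCC hβC hβD hβQ small hPB hL in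
/-- **(K57) §2 (THE TRANSPOSED ROW) UNDER THE SAME MASS CHOICE** — the eleven windows of
`B9Eq326LocalPartDivergenceBlockLetterClosed.norm_localInv_covDerivL2K_le_blockLetter` discharged verbatim as in §1; beyond §1's data, `hessOp` symmetric and
a site block family `PS` given pointwise; for `g` supported over the sites of `B(u)` (`sup ≤ G`) and every bond `b`:
`‖(A₀⁻¹(D_U g))(b)‖ ≤ (§1's constant)·L^d·e^{−r·d_m(B(b₋),u)}·G`. [folklore]
[cite: Balaban1985BackgroundPropagators, Thm 3.1 (3.42) p.397, p.398, (3.26) p.395, (3.8) p.392; Balaban1984PropagatorsI, (1.29) p.23, p.36] -/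
theorem norm_localInv_covDerivL2K_le_blockLetter_of_mass (hd : 1 ≤ d) (hn : ∀ ν, 2 ≤ fineP L m ν)
    {aU : ℝ} (haU : 0 ≤ aU) (hUa : ∀ (x : TSite d (fineP L m)) (μ : Fin d), ‖(U (x, μ) : 𝔸) - (U (unshift μ x, μ) : 𝔸)‖ ≤ aU)
    {mm : ℝ} (hmm2 : 2 ≤ mm) (hwin4 : 4 * (d : ℝ) * (Real.cosh r - 1) ≤ mm)
    (hmε : 2 * ((η⁻¹ * (2 * Mφ * Mφ' * εU)) * (Real.exp 1 + 1) * (d : ℝ) * ((1 + 2 / 1) * Real.sqrt 2 + 4 * Real.sinh r)) ≤ Real.sqrt mm)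
    (hH : (hessOp (c₀ := c₀) φ η U τ).IsSymmetric)
    (PS : TSite d m → SiteL2K ℂ d (fineP L m) c₀ W →L[ℂ] SiteL2K ℂ d (fineP L m) c₀ W)
    (hPS : ∀ (y : TSite d m) (g : SiteL2K ℂ d (fineP L m) c₀ W) (x : TSite d (fineP L m)),
      WL2.equiv ℂ (fun _ : TSite d (fineP L m) => c₀) W (PS y g) x =
        if blockCoord L m x = y then WL2.equiv ℂ (fun _ : TSite d (fineP L m) => c₀) W g x else 0)
    (u : TSite d m) (g : SiteL2K ℂ d (fineP L m) c₀ W) (G : ℝ)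
    (hgu : ∀ x, blockCoord L m x ≠ u → WL2.equiv ℂ (fun _ : TSite d (fineP L m) => c₀) W g x = 0)
    (hgG : ∀ x, ‖WL2.equiv ℂ (fun _ : TSite d (fineP L m) => c₀) W g x‖ ≤ G) (b : Bond d (fineP L m)) :
    ‖WL2.equiv ℂ (fun _ : Bond d (fineP L m) => c₀) W
        (greenK A₀ hpos₀ (covDerivL2K ℂ c₀ ((η : ℂ))⁻¹ (adTransportW φ U) g)) b‖ ≤
      (2 * Real.exp ((r * η) * ((L : ℝ) - 1)) *
        ((2 * ‖((η⁻¹ : ℝ) : ℂ)‖ * ∑ ν, (fun ν : Fin d => (1 + Real.exp (-(r * η))) *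
        ((1 + 2 * η⁻¹ / (fineP L m ν * Real.sqrt (mm - 2 * ((d : ℝ) - 1) * η⁻¹ ^ 2 * (Real.cosh (r * η) - 1)))) /
          Real.sqrt ((mm - 2 * ((d : ℝ) - 1) * η⁻¹ ^ 2 * (Real.cosh (r * η) - 1)) ^ 2 + 4 * (mm - 2 * ((d : ℝ) - 1) * η⁻¹ ^ 2 * (Real.cosh (r * η) - 1)) * η⁻¹ ^ 2)) +
        2 * Real.sinh (r * η) / (mm - 2 * (d : ℝ) * η⁻¹ ^ 2 * (Real.cosh (r * η) - 1))) ν) +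
          (2 * (‖((η⁻¹ : ℝ) : ℂ)‖ * (((768 * Fintype.card (DirPair d) * Mτ * Mφ ^ 2 * (‖((η : ℂ)) ^ d‖ / c₀) * ‖((η : ℂ))⁻¹‖ ^ 2 * δ * Real.exp (r * η) ^ 2 +
          |a| * (c₁ / c₀ * (Mφ' * (1 + 50 * (d + 1) * α) * Mφ) * ((2 * d : ℕ) : ℝ) * (Mφ' * (1 + 50 * (d + 1) * α) * Mφ)) *
            Real.exp ((r * η) * (d : ℝ) * ((L : ℝ) * 2 + ((L : ℝ) - 1))) +
          ‖((η : ℂ))⁻¹ * ((η : ℂ))⁻¹‖ * ((d - 1 : ℝ) * (2 * Mφ * Mφ' * (2 * δ)) * Real.exp (r * η) ^ 2)) + ‖((mm : ℝ) : ℂ)‖) +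
              (d : ℝ) * (η⁻¹ ^ 2 * (2 * Mφ * Mφ' * aU + (2 * Mφ * Mφ' * εU) * (2 * Mφ * Mφ' * εU)))) + |η⁻¹| * (2 * Mφ * Mφ' * εU) / ((1 + Real.exp (-(r * η))) / Real.sqrt ((mm - 2 * ((d : ℝ) - 1) * η⁻¹ ^ 2 * (Real.cosh (r * η) - 1)) ^ 2 +
              4 * (mm - 2 * ((d : ℝ) - 1) * η⁻¹ ^ 2 * (Real.cosh (r * η) - 1)) * η⁻¹ ^ 2))) *
            (∑ ν, (fun ν : Fin d => (1 + Real.exp (-(r * η))) *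
        ((1 + 2 * η⁻¹ / (fineP L m ν * Real.sqrt (mm - 2 * ((d : ℝ) - 1) * η⁻¹ ^ 2 * (Real.cosh (r * η) - 1)))) /
          Real.sqrt ((mm - 2 * ((d : ℝ) - 1) * η⁻¹ ^ 2 * (Real.cosh (r * η) - 1)) ^ 2 + 4 * (mm - 2 * ((d : ℝ) - 1) * η⁻¹ ^ 2 * (Real.cosh (r * η) - 1)) * η⁻¹ ^ 2)) +
        2 * Real.sinh (r * η) / (mm - 2 * (d : ℝ) * η⁻¹ ^ 2 * (Real.cosh (r * η) - 1))) ν)) * (4 / γ * Real.exp r * Real.sqrt (d * (L : ℝ) ^ d)))) * (L : ℝ) ^ d * Real.exp (-(r * tdist m (blockCoord L m (bpos b)) u)) * G := by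
  -- the units: `η⁻¹ = L ≥ 1`, `η ≤ 1`
  have hinvL : η⁻¹ = (L : ℝ) := inv_eq_of_mul_eq_one_right hηL
  have hL1 : (1 : ℝ) ≤ (L : ℝ) := by exact_mod_cast hL
  have ht : (1 : ℝ) ≤ η⁻¹ := by rw [hinvL]; exact hL1
  have ht0 : (0 : ℝ) < η⁻¹ := by linarith
  have hη1 : η ≤ 1 := by
    have h := mul_le_mul_of_nonneg_left hL1 hη.le
    rw [mul_one, hηL] at h
    exact h
  have hmm : 0 < mm := by linarith
  have hsm : 0 < Real.sqrt mm := Real.sqrt_pos.2 hmm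
  -- the rate `θ := rη`
  have hθ : 0 ≤ r * η := mul_nonneg hr hη.le
  have hrθ : r ≤ r * η * (L : ℝ) := by rw [mul_assoc, hηL, mul_one]
  have hθκ : r * η ≤ 1 := by
    have h1 : r * η ≤ r * 1 := mul_le_mul_of_nonneg_left hη1 hr
    linarith
  have hrdiv : r / η⁻¹ = r * η := div_inv_eq_mul r η
  -- the `cosh` window from the t-free window
  have hlam4 := window_of_tfree_window ht hr d hwin4
  rw [hrdiv] at hlam4
  have hlam : 2 * (d : ℝ) * η⁻¹ ^ 2 * (Real.cosh (r * η) - 1) < mm := by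
    have hc : 0 ≤ Real.cosh (r * η) - 1 := by linarith [Real.one_le_cosh (r * η)]
    have h0 : 0 ≤ (d : ℝ) * (η⁻¹ ^ 2 * (Real.cosh (r * η) - 1)) := by positivity
    have e : 2 * (d : ℝ) * η⁻¹ ^ 2 * (Real.cosh (r * η) - 1) = 2 * ((d : ℝ) * (η⁻¹ ^ 2 * (Real.cosh (r * η) - 1))) := by ring
    rw [e]
    linarith
  -- the direction-free lower bound `β₀`
  have hβ0 := fun ν => direction_constant_lower_bound (N := fineP L m) η⁻¹ mm (r * η) ht0 hθ hlam ν
  have hd0 : 0 < d := hd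
  -- the η-uniform row gain `C_W`
  have hCW : 0 ≤ ((1 + 2 / (1 * Real.sqrt (mm / 2))) / Real.sqrt (mm / 2) + 4 * Real.sinh r / mm) := by
    have hs : 0 ≤ Real.sinh r := Real.sinh_nonneg_iff.2 hr
    positivity
  have hLn : ∀ ν : Fin d, (1 : ℝ) * η⁻¹ ≤ (fineP L m ν : ℝ) := fun ν => by
    rw [one_mul, hinvL]
    have h1 : L * 1 ≤ fineP L m ν := Nat.mul_le_mul_left L (hm ν)
    rw [mul_one] at h1
    exact_mod_cast h1
  have hnorm : ‖((η⁻¹ : ℝ) : ℂ)‖ = η⁻¹ := by rw [Complex.norm_real, Real.norm_eq_abs, abs_of_pos ht0]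
  have habs : |η⁻¹| = η⁻¹ := abs_of_pos ht0
  have htB : ∀ ν, ‖((η⁻¹ : ℝ) : ℂ)‖ * (fun ν : Fin d => (1 + Real.exp (-(r * η))) *
        ((1 + 2 * η⁻¹ / (fineP L m ν * Real.sqrt (mm - 2 * ((d : ℝ) - 1) * η⁻¹ ^ 2 * (Real.cosh (r * η) - 1)))) /
          Real.sqrt ((mm - 2 * ((d : ℝ) - 1) * η⁻¹ ^ 2 * (Real.cosh (r * η) - 1)) ^ 2 + 4 * (mm - 2 * ((d : ℝ) - 1) * η⁻¹ ^ 2 * (Real.cosh (r * η) - 1)) * η⁻¹ ^ 2)) +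
        2 * Real.sinh (r * η) / (mm - 2 * (d : ℝ) * η⁻¹ ^ 2 * (Real.cosh (r * η) - 1))) ν ≤ ((1 + 2 / (1 * Real.sqrt (mm / 2))) / Real.sqrt (mm / 2) + 4 * Real.sinh r / mm) := fun ν => by
    have h := mul_weighted_row_le_uniform η⁻¹ ht (m := mm) (κ := r) (n := (fineP L m ν : ℝ)) (L := 1) hmm hr one_pos (hLn ν) d hwin4
    rw [hrdiv] at h
    rw [hnorm]
    exact h
  have hCK : ((1 + 2 / (1 * Real.sqrt (mm / 2))) / Real.sqrt (mm / 2) + 4 * Real.sinh r / mm) ≤ ((1 + 2 / (1 * Real.sqrt (mm / 2))) / Real.sqrt (mm / 2) + 4 * Real.sinh r / mm) * Real.sqrt mm / Real.sqrt mm :=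
    (mul_div_cancel_right₀ _ hsm.ne').symm.le
  have hmK : 2 * ((|η⁻¹| * (2 * Mφ * Mφ' * εU)) * (Real.exp 1 + 1) * (d : ℝ) * (((1 + 2 / (1 * Real.sqrt (mm / 2))) / Real.sqrt (mm / 2) + 4 * Real.sinh r / mm) * Real.sqrt mm)) ≤ Real.sqrt mm := by
    have hCle := uniform_const_le_of_two_le (κ := r) (L := (1 : ℝ)) hmm2 hr one_pos
    have hb0 : 0 ≤ (|η⁻¹| * (2 * Mφ * Mφ' * εU)) * (Real.exp 1 + 1) * (d : ℝ) := by positivity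
    rw [habs] at hb0 ⊢
    calc 2 * ((η⁻¹ * (2 * Mφ * Mφ' * εU)) * (Real.exp 1 + 1) * (d : ℝ) * (((1 + 2 / (1 * Real.sqrt (mm / 2))) / Real.sqrt (mm / 2) + 4 * Real.sinh r / mm) * Real.sqrt mm))
        = 2 * ((η⁻¹ * (2 * Mφ * Mφ' * εU)) * (Real.exp 1 + 1) * (d : ℝ)) * (((1 + 2 / (1 * Real.sqrt (mm / 2))) / Real.sqrt (mm / 2) + 4 * Real.sinh r / mm) * Real.sqrt mm) := by ring
      _ ≤ 2 * ((η⁻¹ * (2 * Mφ * Mφ' * εU)) * (Real.exp 1 + 1) * (d : ℝ)) *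
            (((1 + 2 / 1) * Real.sqrt 2 + 4 * Real.sinh r) / Real.sqrt mm * Real.sqrt mm) :=
          mul_le_mul_of_nonneg_left (mul_le_mul_of_nonneg_right hCle hsm.le) (by positivity)
      _ = 2 * ((η⁻¹ * (2 * Mφ * Mφ' * εU)) * (Real.exp 1 + 1) * (d : ℝ) * ((1 + 2 / 1) * Real.sqrt 2 + 4 * Real.sinh r)) := by
          rw [div_mul_cancel₀ _ hsm.ne']; ring
      _ ≤ Real.sqrt mm := hmε
  exact B9Eq326LocalPartDivergenceBlockLetterClosed.norm_localInv_covDerivL2K_le_blockLetter L m hL φ hφ hφ' hMφ hMφ' hstar hη hηL U hU hRS hα1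
    hU1 hreg hα1' hU1' hreg' hεU hUε τ hτ hMτ hδ hRe hIm a ha hm A₀ hA₀ hpos₀ hγ hβ hr hcoer hwin hr4 hβCC hβC hβD hβQ small PB hPB hd hn haU hUa hθ hrθ
    hmm hlam (hβ0 ⟨0, hd0⟩).1 (fun ν => (hβ0 ν).2) hθκ hCW htB hCK hmK hH PS hPS u g G hgu hgG b

end Literature.MathematicalPhysics.QuantumFieldTheory.Balaban1983to89.B9Eq326LocalPartGradientRowsWindows

end
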